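import Literature.Geometry.Symplectic.DiagonalThomClassFour
import Literature.AlgebraicTopology.CharacteristicClasses.CompletionThomClassIndexUnit
import Literature.AlgebraicTopology.SingularHomology.LocalDegreeSign
import Literature.AlgebraicTopology.SingularHomology.RelativeKroneckerAbsolute
import Literature.AlgebraicTopology.SingularHomology.WuClasses
import HarnessLib

/-!
# The diagonal class restricts on each slice to the dual of the point: `⟨j_x^* u'', [M]₂⟩ = 1`

J. Milnor, J. Stasheff, *Characteristic Classes* (1974), §11 Lemma 11.9 (p. 123): for the diagonal
class `u'' ∈ Hⁿ(M × M)` of a closed manifold and the slice `j_x : M → M × M`, `y ↦ (x, y)`, the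
restriction `j_x^* u'` to `(M, M ∖ x)` is the preferred generator, i.e. `⟨j_x^* u'', [M]⟩ = 1` — the
Thom class restricts on each fibre to the preferred generator (Thm. 9.1 / 10.4).  This file PROVES the
mod-2 version in dimension `4` for the diagonal class `diagClass` of an almost complex `4`-manifold
(`DiagonalThomClassFour.lean`):

* `xpow_top_ne_zero` — `xᵏ ≠ 0` in `H²ᵏ(ℙ(V); R)`, `dim V = k + 1`, `R` non-trivial (injectivity half
  of the Leray–Hirsch bijection `projectiveSpace_lerayHirsch` over a point);
* `relKroneckerM_localClass_eq_one_of_ne_zero` — a non-zero class of `Hⁿ(X, X ∖ x; 𝔽₂)` pairs to `1`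
  with the local `𝔽₂`-orientation (`relKroneckerM_bijective_of_field`, `Hₙ(X | x) = 𝔽₂ μ_x`);
  `relMap_injective_of_isOpenEmbedding` — open embeddings fixing base points are injective on `Hⁿ` of
  the punctured pairs (`localHomology.isIso_map_of_isOpenEmbedding_of_eq` dualised);
* `sliceRelClass` (`u'_x = j_x^* u'`), `kroneckerPairing_map_sliceMap_diagClass`
  (`⟨j_x^* u'', [M]₂⟩ = ⟨u'_x, μ_x⟩`), `map_subsetIncl_sliceRelClass` (`u'_x|_{N_x} = (Φ ∘ e⁻¹ ∘ j_x)^* t̃`);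
* `sliceLog` (`L_x = e⁻¹(x, ·) : N_x → T_xM`, an open embedding with `L_x x = 0`,
  `isOpenEmbedding_sliceLog`), `fibreMap` (`φ_x : w ↦ [w : 1] ∈ D_x`), `sliceComposite_eq`
  (`Φ ∘ e⁻¹ ∘ j_x = φ_x ∘ L_x`);
* `fibreIncl`, `fibreClass` (`t̃_x = κ_x^* t̃` on the fibre `ℙ(F ⊕ ℂ)` of `D` over `x`),
  `map_fibreIncl_complThomClass` (`κ_x^* t = xᵏ`), `fibreClass_ne_zero`, `fibreMap_eq_comp`
  (`φ_x = κ_x ∘ α ∘ frame`), **`relMap_fibreMap_ne_zero`** (`φ_x^* t̃ ≠ 0`);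
* **`sliceRelClass_ne_zero`**, **`kroneckerPairing_map_sliceMap_diagClass_eq_one`** —
  `⟨j_x^* u'', [M]₂⟩ = 1`.

No named facts; the definitions are constructions (D-0026).  Written for Wu's formula
`c₁(TM, J) ≡ v₂(M)` (`firstChernClass_modTwo_eq_wuClass_almostComplex_four`).

## References

* J. Milnor, J. Stasheff, *Characteristic Classes*, Ann. of Math. Stud. 76 (1974), §9 Thm. 9.1,
  §10 Thm. 10.4, §11 Lemma 11.9. [MilnorStasheff1974]
* A. Hatcher, *Algebraic Topology*, CUP 2002, §3.1 Thm. 3.2, §3.3 p. 231 and Thm. 3.26. [HatcherAT2002]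
* D. Husemoller, *Fibre Bundles*, 3rd ed. (1994), Ch. 17 §2 (2.3), Def. 2.1. [HusemollerFibreBundles1994]
-/

noncomputable section

open CategoryTheory Function Set Bundle
open Literature.AlgebraicTopology.SingularHomology Literature.AlgebraicTopology.CharacteristicClasses
open Literature.AlgebraicTopology.CharacteristicClasses.ComplexVectorBundle
open scoped Manifold ContDiff Topology LinearAlgebra.Projectivization
open Topology

namespace Literature.Geometry.Symplectic

namespace AlmostComplexStructure

variable {M : Type} [TopologicalSpace M] [T2Space M] [CompactSpace M]
  [ChartedSpace (EuclideanSpace ℝ (Fin 4)) M] [IsManifold (𝓡 4) ∞ M]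
  (J : AlmostComplexStructure (𝓡 4) ∞ M)

/-! ### The fibre normalisation `⟨j_x^* u'', [M]₂⟩ = 1` (Milnor–Stasheff Lemma 11.9 mod 2) -/

section ModelFacts

/-- **`xᵏ ≠ 0` in `H²ᵏ(ℙ(V); R)` for `dim V = k + 1`** and a non-trivial ring `R` (Husemoller (2.3):
`H*(ℂPᵏ; R)` is free on `1, x, …, xᵏ`; here from the injectivity half of the tree's Leray–Hirsch
bijection `projectiveSpace_lerayHirsch` over a point). [cite: HusemollerFibreBundles1994, Ch. 17 §2 (2.3)] -/
theorem xpow_top_ne_zero (R : Type) [CommRing R] [Nontrivial R] (V : Type) [NormedAddCommGroup V] [NormedSpace ℂ V]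
    [FiniteDimensional ℂ V] {k : ℕ} (hV : Module.finrank ℂ V = k + 1) : xpow R V k ≠ 0 := by
  classical
  intro h0
  have hLH := (projectiveSpace_lerayHirsch R k V hV) PUnit.{1} (2 * k)
  have h2k : 2 * k ≤ 2 * k := le_rfl
  -- the source tuple with `1` in the top slot
  let w₀ : LerayHirsch.Src R (LerayHirsch.evenDeg (k + 1)) PUnit.{1} (2 * k) := fun j ↦
    if hj : (j.1 : ℕ) = k then degCast R (by
        change 0 = 2 * k - 2 * (j.1 : ℕ)
        rw [hj, Nat.sub_self]) (singularCohomology.one R PUnit.{1})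
    else 0
  have hw₀ : LerayHirsch.lhMap R (LerayHirsch.evenDeg (k + 1)) (ContinuousMap.fst : C(PUnit.{1} × ℙ ℂ V, PUnit.{1}))
      (projCls R V PUnit.{1} (k + 1)) (2 * k) w₀ = 0 := by
    rw [LerayHirsch.lhMap_apply]
    refine Finset.sum_eq_zero fun j _ ↦ ?_
    split_ifs with hle
    · by_cases hj : (j : ℕ) = k
      · -- the top term: `1 ⌣ pr₂^* xᵏ = pr₂^* xᵏ = 0`
        have hcls : projCls R V PUnit.{1} (k + 1) j = 0 := by
          change singularCohomology.map R R (ContinuousMap.snd : C(PUnit.{1} × ℙ ℂ V, ℙ ℂ V)) (2 * (j : ℕ)) (xpow R V j) = 0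
          rw [hj, h0, map_zero]
        rw [hcls, map_zero]
      · have hz : w₀ ⟨j, hle⟩ = 0 := by
          change (if hj : ((⟨j, hle⟩ : LerayHirsch.Idx (LerayHirsch.evenDeg (k + 1)) (2 * k)).1 : ℕ) = k then _ else _) = 0
          rw [dif_neg hj]
        rw [hz, map_zero, LinearMap.map_zero₂]
    · rfl
  have hzero : w₀ = 0 := hLH.1 (hw₀.trans (map_zero _).symm)
  have htop := congrFun hzero ⟨Fin.last k, h2k⟩
  have hk : ((⟨Fin.last k, h2k⟩ : LerayHirsch.Idx (LerayHirsch.evenDeg (k + 1)) (2 * k)).1 : ℕ) = k := rfl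
  change (if hj : ((⟨Fin.last k, h2k⟩ : LerayHirsch.Idx (LerayHirsch.evenDeg (k + 1)) (2 * k)).1 : ℕ) = k then _ else _) = 0 at htop
  rw [dif_pos hk] at htop
  have h1 : singularCohomology.one R PUnit.{1} = 0 := by
    have e₀ : 0 = 2 * k - 2 * ((⟨Fin.last k, h2k⟩ : LerayHirsch.Idx (LerayHirsch.evenDeg (k + 1)) (2 * k)).1 : ℕ) := by
      change 0 = 2 * k - 2 * k; rw [Nat.sub_self]
    have := congrArg (degCast R e₀.symm) htop
    rwa [degCast_symm_apply_degCast, map_zero] at this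
  exact one_ne_zero (eq_zero_of_smul_one_punit R (r := 1) (by rw [one_smul]; exact h1))

/-- **A non-zero class of `H⁴(X, X ∖ x; 𝔽₂)` pairs to `1` with the local orientation generator**
(`Hⁿ(X, X ∖ x; 𝔽₂) ≅ Hom(Hₙ(X | x; 𝔽₂), 𝔽₂)`, Hatcher Thm. 3.2 over the field `𝔽₂`, and `Hₙ(X | x) = 𝔽₂ μ_x`).
[cite: HatcherAT2002, §3.1 Thm. 3.2 and §3.3 p. 231] -/
theorem relKroneckerM_localClass_eq_one_of_ne_zero {X : Type} [TopologicalSpace X] {n : ℕ}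
    (μ : HomologicalOrientation (ZMod 2) X n) (x : X) {c : relSingularCohomology (ZMod 2) (ZMod 2) X {x}ᶜ n}
    (hc : c ≠ 0) : relKroneckerM (ZMod 2) X {x}ᶜ n c (μ.localClass x) = 1 := by
  haveI : Fact (Nat.Prime 2) := ⟨Nat.prime_two⟩
  obtain ⟨γ, hγ⟩ : ∃ γ, relKroneckerM (ZMod 2) X {x}ᶜ n c γ ≠ 0 := by
    by_contra h
    refine hc ((relSingularCohomology_eq_zero_iff (ZMod 2) c).2 fun γ ↦ ?_)
    by_contra hγ
    exact h ⟨γ, hγ⟩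
  obtain ⟨eqv, heqv⟩ := μ.isGenerator x
  have hγ' : γ = (eqv γ) • μ.localClass x := by
    apply eqv.injective
    rw [map_smul, heqv, smul_eq_mul, mul_one]
  rw [hγ', map_smul, smul_eq_mul] at hγ
  have hval : relKroneckerM (ZMod 2) X {x}ᶜ n c (μ.localClass x) ≠ 0 := fun h0 ↦ hγ (by rw [h0, mul_zero])
  revert hval
  generalize relKroneckerM (ZMod 2) X {x}ᶜ n c (μ.localClass x) = a
  intro hval
  fin_cases a
  · exact absurd rfl hval
  · rfl

/-- **An open embedding fixing the base points is injective on `Hⁿ` of the punctured pairs with field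
coefficients** (its `Hₙ` push-forward is an isomorphism of local homologies, Hatcher §3.3 p. 231, and
`f^*` is dual to `f_*` over a field). [cite: HatcherAT2002, §3.3 p. 231 and §3.1 p. 201] -/
theorem relMap_injective_of_isOpenEmbedding {X Y : Type} [TopologicalSpace X] [TopologicalSpace Y] [T1Space Y]
    (f : C(X, Y)) (hf : IsOpenEmbedding f) (a : X) {b : Y} (hb : f a = b) (n : ℕ) :
    Injective (relSingularCohomology.map (ZMod 2) (ZMod 2) f (mapsTo_compl_singleton_of_injective hf.injective hb) n) := by
  haveI : Fact (Nat.Prime 2) := ⟨Nat.prime_two⟩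
  haveI := localHomology.isIso_map_of_isOpenEmbedding_of_eq (ZMod 2) (ZMod 2) f hf a hb n
  exact relSingularCohomology_map_injective_of_surjective (ZMod 2) f _
    (ConcreteCategory.bijective_of_isIso (relativeSingularHomology.map (ZMod 2) (ZMod 2) f
      (mapsTo_compl_singleton_of_injective hf.injective hb) n)).2

end ModelFacts

section Fibre

variable (ex : C(TangentBundle (𝓡 4) M, M)) (e : OpenPartialHomeomorph (TangentBundle (𝓡 4) M) (M × M))
  (he : ∀ v, e v = (v.proj, ex v)) (hez : ∀ v ∈ e.source, ex v = v.proj ↔ v.snd = 0)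
  (he0 : ∀ x : M, (⟨x, 0⟩ : TangentBundle (𝓡 4) M) ∈ e.source) (hΔ : ∀ x : M, (x, x) ∈ e.target) (x : M)

/-- **The slice `j_x : M → M × M`, `y ↦ (x, y)`.** [cite: MilnorStasheff1974, §11 Lemma 11.9] -/
abbrev sliceMap (x : M) : C(M, M × M) := (ContinuousMap.const M x).prodMk (ContinuousMap.id M)

omit [T2Space M] [CompactSpace M] [ChartedSpace (EuclideanSpace ℝ (Fin 4)) M] [IsManifold (𝓡 4) ∞ M] in
/-- `j_x` is a map of pairs `(M, M ∖ x) → (M × M, M × M ∖ Δ)`. [folklore] -/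
theorem mapsTo_sliceMap : MapsTo (sliceMap x) ({x}ᶜ : Set M) {p : M × M | p.1 ≠ p.2} :=
  fun _ hy h ↦ hy (mem_singleton_iff.2 h.symm)

/-- **`u'_x = j_x^* u' ∈ H⁴(M, M ∖ x; 𝔽₂)`.** [cite: MilnorStasheff1974, §11 Lemma 11.9] -/
def sliceRelClass : relSingularCohomology (ZMod 2) (ZMod 2) M ({x}ᶜ : Set M) 4 :=
  relSingularCohomology.map (ZMod 2) (ZMod 2) (sliceMap x) (mapsTo_sliceMap x) 4 (J.diagRelClass ex e he hez hΔ)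

/-- **`⟨j_x^* u'', [M]₂⟩ = ⟨u'_x, μ_x⟩`** (naturality of `j^*`, `⟨j^*w, [M]⟩ = ⟨w, j_*[M]⟩` and
`j_*[M] = μ_x`, the defining property of the fundamental class). [cite: HatcherAT2002, §3.3 Thm. 3.26] -/
theorem kroneckerPairing_map_sliceMap_diagClass :
    kroneckerPairing (ZMod 2) (ZMod 2) M 4
        (singularCohomology.map (ZMod 2) (ZMod 2) (sliceMap x) 4 (J.diagClass ex e he hez hΔ)) (modTwoFundamentalClass M 4) =
      relKroneckerM (ZMod 2) M ({x}ᶜ : Set M) 4 (J.sliceRelClass ex e he hez hΔ x) ((modTwoOrientation M 4).localClass x) := by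
  rw [diagClass, ← ModuleCat.comp_apply, ← relSingularCohomology.map_comp_toAbsolute, ModuleCat.comp_apply,
    kroneckerPairing_toAbsolute]
  exact congrArg _ ((HomologicalOrientation.isFundamentalClass_fundamentalClass_holds 4 (modTwoOrientation M 4)) x)

/-! #### The slice through the tube: `u'_x|_{N_x} = (Φ ∘ Ψ ∘ j_x)^* t̃` -/

/-- The lift of the slice into the tube, `y ↦ (x, y) ∈ N` for `y ∈ N_x = j_x⁻¹ N`. [folklore] -/
abbrev sliceLift : C(↥(sliceMap x ⁻¹' e.target), ↥e.target) :=
  ⟨fun y ↦ ⟨sliceMap x y.1, y.2⟩, ((sliceMap x).continuous.comp continuous_subtype_val).subtype_mk _⟩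

/-- The base point of the slice neighbourhood. [folklore] -/
abbrev slicePt : ↥(sliceMap x ⁻¹' e.target) := ⟨x, hΔ x⟩

omit [T2Space M] [CompactSpace M] in
include he hez in
/-- The composite `Φ ∘ Ψ ∘ (slice lift)` is a map of pairs `(N_x, N_x ∖ x) → (D, D ∖ s₀)`. [folklore] -/
theorem mapsTo_sliceComposite :
    MapsTo (J.tangentComplMap.comp ((tubeInverse e).comp (sliceLift e x)))
      ({slicePt e hΔ x}ᶜ : Set ↥(sliceMap x ⁻¹' e.target)) (vectorPart J.complexTangentBundle.F J.complexTangentBundle.E) := by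
  intro y hy
  refine J.mapsTo_tangentComplMap (mapsTo_tubeInverse ex e he hez ?_)
  change x ≠ y.1
  intro hxy
  exact hy (Subtype.ext hxy.symm)

/-- **`u'_x|_{N_x} = (Φ ∘ Ψ ∘ j_x)^* t̃₄`** (unwinding the excision and the tube). [cite: MilnorStasheff1974, §11 Lemma 11.9] -/
theorem map_subsetIncl_sliceRelClass :
    relSingularCohomology.map (ZMod 2) (ZMod 2) (subsetIncl (sliceMap x ⁻¹' e.target))
        (show MapsTo (subsetIncl (sliceMap x ⁻¹' e.target)) ({slicePt e hΔ x}ᶜ : Set ↥(sliceMap x ⁻¹' e.target)) ({x}ᶜ : Set M) from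
          fun _ hy h ↦ hy (Subtype.ext h)) 4 (J.sliceRelClass ex e he hez hΔ x) =
      relSingularCohomology.map (ZMod 2) (ZMod 2) (J.tangentComplMap.comp ((tubeInverse e).comp (sliceLift e x)))
        (J.mapsTo_sliceComposite ex e he hez hΔ x) 4
        (ComplexVectorBundle.relDegCast (ZMod 2) J.two_mul_rank_complexTangentBundle_four
          (J.complexTangentBundle.relComplThomClass (ZMod 2) J.rank_complexTangentBundle_four_pos)) := by
  have hsq : (sliceMap x).comp (subsetIncl (sliceMap x ⁻¹' e.target)) = (subsetIncl e.target).comp (sliceLift e x) := rfl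
  have h1 : MapsTo (sliceLift e x) ({slicePt e hΔ x}ᶜ : Set ↥(sliceMap x ⁻¹' e.target))
      (Subtype.val ⁻¹' {p : M × M | p.1 ≠ p.2}) := by
    intro y hy (h : x = y.1)
    exact hy (Subtype.ext h.symm)
  rw [sliceRelClass, ← ModuleCat.comp_apply, ← relSingularCohomology.map_comp,
    relSingularCohomology.map_congr hsq ((mapsTo_sliceMap x).comp
      (show MapsTo (subsetIncl (sliceMap x ⁻¹' e.target)) ({slicePt e hΔ x}ᶜ : Set ↥(sliceMap x ⁻¹' e.target)) ({x}ᶜ : Set M) from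
        fun y hy h ↦ hy (Subtype.ext h)))
      ((mapsTo_preimage Subtype.val {p : M × M | p.1 ≠ p.2}).comp h1) 4,
    relSingularCohomology.map_comp, ModuleCat.comp_apply, J.map_subsetIncl_diagRelClass, tubeClass, tau,
    ← ModuleCat.comp_apply, ← relSingularCohomology.map_comp, ← ModuleCat.comp_apply, ← relSingularCohomology.map_comp]
  · exact h1
  · exact mapsTo_preimage Subtype.val {p : M × M | p.1 ≠ p.2}

/-! #### The fibre map `φ_x : (T_xM, T_xM ∖ 0) → (D, D ∖ s₀)` and the log `L_x : N_x → T_xM` -/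

/-- **`φ_x : T_xM → D`, `w ↦ Φ(x, w) = [w : 1] ∈ D_x`.** [cite: MilnorStasheff1974, §11 Lemma 11.9] -/
abbrev fibreMap : C(EuclideanSpace ℝ (Fin 4), J.complexTangentBundle.compl.Proj) :=
  J.tangentComplMap.comp ⟨fun w ↦ (⟨x, w⟩ : TangentBundle (𝓡 4) M),
    FiberBundle.continuous_totalSpaceMk (F := EuclideanSpace ℝ (Fin 4)) (E := (TangentSpace (𝓡 4) : M → Type _)) x⟩

omit [T2Space M] [CompactSpace M] in
/-- `φ_x` is a map of pairs. [folklore] -/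
theorem mapsTo_fibreMap : MapsTo (J.fibreMap x) ({0}ᶜ : Set (EuclideanSpace ℝ (Fin 4)))
    (vectorPart J.complexTangentBundle.F J.complexTangentBundle.E) :=
  fun _ hw ↦ J.mapsTo_tangentComplMap hw

omit [T2Space M] [CompactSpace M] in
/-- Reading the fibre coordinate of a vector over `x` in the trivialisation at `x` gives the vector. [folklore] -/
theorem trivializationAt_snd_of_proj_eq {v : TangentBundle (𝓡 4) M} (hv : v.proj = x) :
    (trivializationAt (EuclideanSpace ℝ (Fin 4)) (TangentSpace (𝓡 4)) x v).2 = v.snd := by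
  obtain ⟨p, w⟩ := v
  change p = x at hv
  subst hv
  exact tangentCoordChange_self (mem_extChartAt_source p)

/-- **The log of the tube along the slice, `L_x : N_x → T_xM`, `y ↦ e⁻¹(x, y)`** (read in the
trivialisation of `TM` at `x`, which is the identity on `T_xM`). [cite: MilnorStasheff1974, §11 Thm. 11.1] -/
def sliceLog : C(↥(sliceMap x ⁻¹' e.target), EuclideanSpace ℝ (Fin 4)) where
  toFun y := (trivializationAt (EuclideanSpace ℝ (Fin 4)) (TangentSpace (𝓡 4)) x (tubeInverse e (sliceLift e x y))).2
  continuous_toFun := by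
    refine continuous_snd.comp ?_
    refine (trivializationAt (EuclideanSpace ℝ (Fin 4)) (TangentSpace (𝓡 4)) x).continuousOn.comp_continuous
      ((tubeInverse e).continuous.comp (sliceLift e x).continuous) fun y ↦ ?_
    rw [(trivializationAt (EuclideanSpace ℝ (Fin 4)) (TangentSpace (𝓡 4)) x).mem_source,
      TangentBundle.trivializationAt_baseSet]
    change (tubeInverse e (sliceLift e x y)).proj ∈ (chartAt (EuclideanSpace ℝ (Fin 4)) x).source
    rw [proj_tubeInverse ex e he]
    exact mem_chart_source _ x

omit [T2Space M] [CompactSpace M] in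
include he in
/-- `L_x y` IS the vector `e⁻¹(x, y)`. [folklore] -/
theorem sliceLog_apply (y : ↥(sliceMap x ⁻¹' e.target)) :
    sliceLog ex e he x y = (tubeInverse e (sliceLift e x y)).snd :=
  trivializationAt_snd_of_proj_eq x (proj_tubeInverse ex e he (sliceLift e x y))

omit [T2Space M] [CompactSpace M] in
include he in
/-- `e⁻¹(x, y) = (x, L_x y)` in `TM`. [folklore] -/
theorem tubeInverse_sliceLift (y : ↥(sliceMap x ⁻¹' e.target)) :
    tubeInverse e (sliceLift e x y) = ⟨x, sliceLog ex e he x y⟩ :=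
  Bundle.TotalSpace.ext (proj_tubeInverse ex e he _) (heq_of_eq (sliceLog_apply ex e he x y)).symm

omit [T2Space M] [CompactSpace M] in
include he in
/-- **`Φ ∘ Ψ ∘ j_x = φ_x ∘ L_x` on `N_x`.** [folklore] -/
theorem sliceComposite_eq :
    J.tangentComplMap.comp ((tubeInverse e).comp (sliceLift e x)) = (J.fibreMap x).comp (sliceLog ex e he x) :=
  ContinuousMap.ext fun y ↦ congrArg J.tangentComplMap (tubeInverse_sliceLift ex e he x y)

omit [T2Space M] [CompactSpace M] in
include he hez in
/-- `L_x` is a map of pairs `(N_x, N_x ∖ x) → (T_xM, T_xM ∖ 0)`. [folklore] -/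
theorem sliceLog_ne_zero {y : ↥(sliceMap x ⁻¹' e.target)} (hy : y ≠ slicePt e hΔ x) : sliceLog ex e he x y ≠ 0 := by
  rw [sliceLog_apply ex e he x y]
  refine mapsTo_tubeInverse ex e he hez (?_ : x ≠ y.1)
  intro hxy
  exact hy (Subtype.ext hxy.symm)

omit [T2Space M] [CompactSpace M] in
include he hez he0 in
/-- `L_x x = 0`. [folklore] -/
theorem sliceLog_slicePt : sliceLog ex e he x (slicePt e hΔ x) = 0 := by
  rw [sliceLog_apply ex e he x]
  have h : tubeInverse e (sliceLift e x (slicePt e hΔ x)) = ⟨x, 0⟩ := by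
    change e.symm (x, x) = _
    have h1 : e ⟨x, 0⟩ = (x, x) := by
      rw [he]
      exact Prod.ext rfl ((hez _ (he0 x)).2 rfl)
    rw [← h1]
    exact e.left_inv (he0 x)
  rw [h]
  rfl

omit [T2Space M] [CompactSpace M] in
include he in
/-- **`L_x` is an open embedding** (a homeomorphism onto the open set `{w | (x, w) ∈ source e}`, with
inverse `w ↦ ex (x, w)`). [cite: MilnorStasheff1974, §11 Thm. 11.1] -/
theorem isOpenEmbedding_sliceLog : IsOpenEmbedding (sliceLog ex e he x) := by
  set A : Set (EuclideanSpace ℝ (Fin 4)) := {w | (⟨x, w⟩ : TangentBundle (𝓡 4) M) ∈ e.source} with hA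
  have hAo : IsOpen A := e.open_source.preimage
    (FiberBundle.continuous_totalSpaceMk (F := EuclideanSpace ℝ (Fin 4)) (E := (TangentSpace (𝓡 4) : M → Type _)) x)
  have hmemA : ∀ y : ↥(sliceMap x ⁻¹' e.target), sliceLog ex e he x y ∈ A := fun y ↦ by
    change (⟨x, sliceLog ex e he x y⟩ : TangentBundle (𝓡 4) M) ∈ e.source
    rw [← tubeInverse_sliceLift ex e he x y]
    exact e.map_target (sliceLift e x y).2
  have hmemN : ∀ w : ↥A, (x, ex ⟨x, w.1⟩) ∈ e.target := fun w ↦ by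
    have h := e.map_source w.2
    rwa [he] at h
  let Θ : ↥(sliceMap x ⁻¹' e.target) ≃ₜ ↥A :=
    { toFun := fun y ↦ ⟨sliceLog ex e he x y, hmemA y⟩
      invFun := fun w ↦ ⟨ex ⟨x, w.1⟩, hmemN w⟩
      left_inv := fun y ↦ by
        apply Subtype.ext
        change ex ⟨x, sliceLog ex e he x y⟩ = y.1
        rw [← tubeInverse_sliceLift ex e he x y]
        exact ex_tubeInverse ex e he _
      right_inv := fun w ↦ by
        apply Subtype.ext
        change sliceLog ex e he x ⟨ex ⟨x, w.1⟩, hmemN w⟩ = w.1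
        rw [sliceLog_apply ex e he x]
        have h1 : tubeInverse e (sliceLift e x ⟨ex ⟨x, w.1⟩, hmemN w⟩) = ⟨x, w.1⟩ := by
          change e.symm (x, ex ⟨x, w.1⟩) = _
          have h2 : e ⟨x, w.1⟩ = (x, ex ⟨x, w.1⟩) := he _
          rw [← h2]
          exact e.left_inv w.2
        rw [h1]
      continuous_toFun := (sliceLog ex e he x).continuous.subtype_mk _
      continuous_invFun := ((ex.continuous.comp
        ((FiberBundle.continuous_totalSpaceMk (F := EuclideanSpace ℝ (Fin 4)) (E := (TangentSpace (𝓡 4) : M → Type _)) x).comp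
          continuous_subtype_val))).subtype_mk _ }
  have hfac : (sliceLog ex e he x : ↥(sliceMap x ⁻¹' e.target) → EuclideanSpace ℝ (Fin 4)) = Subtype.val ∘ Θ := rfl
  rw [hfac]
  exact hAo.isOpenEmbedding_subtypeVal.comp Θ.isOpenEmbedding

/-! #### The fibre class is non-zero: `φ_x^* t̃ ≠ 0` in `H⁴(T_xM, T_xM ∖ 0; 𝔽₂)` -/

/-- The atlas trivialisation of `(TM, J)` at `x`, read on the fibre over `x`. [folklore] -/
abbrev trivAt : J.complexTangentBundle.E x ≃L[ℂ] J.complexTangentBundle.F :=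
  linEquivAt ℂ J.complexTangentBundle.F J.complexTangentBundle.E (J.complexTangentBundle.triv x) x

/-- The model frame at `x`: `T_xM = ℝ⁴ → (T_xM, J_x) ≅ ℂ² = F`, the complex fibre identification
followed by the atlas trivialisation of `(TM, J)` at `x`. [folklore] -/
abbrev fibreFrame : C(EuclideanSpace ℝ (Fin 4), J.complexTangentBundle.F) :=
  ⟨fun w ↦ J.trivAt x (((J.complexTangentCore_fiberEquiv x).symm w : J.complexTangentBundle.E x)),
    (J.trivAt x).continuous.comp (J.complexTangentCore_fiberEquiv x).symm.continuous⟩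

omit [T2Space M] [CompactSpace M] in
/-- The model frame is an open embedding (a homeomorphism) fixing `0`. [folklore] -/
theorem isOpenEmbedding_fibreFrame : IsOpenEmbedding (J.fibreFrame x) :=
  (J.trivAt x).toHomeomorph.isOpenEmbedding.comp (J.complexTangentCore_fiberEquiv x).symm.toHomeomorph.isOpenEmbedding

omit [T2Space M] [CompactSpace M] in
/-- `fibreFrame 0 = 0`. [folklore] -/
theorem fibreFrame_zero : J.fibreFrame x 0 = 0 := by
  have h1 : (J.complexTangentCore_fiberEquiv x).symm 0 = 0 := map_zero _
  change J.trivAt x ((J.complexTangentCore_fiberEquiv x).symm 0) = 0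
  rw [h1]
  exact map_zero _

/-! #### The fibre of `D` over `x` and the fibre class -/

/-- The closed chart neighbourhood of `x` lies in the base set of the atlas chart at `x`. [folklore] -/
theorem chartNhd_subset_baseSet : J.complexTangentBundle.chartNhd x ⊆ (J.complexTangentBundle.triv x).baseSet :=
  (J.complexTangentBundle.chartNhd_spec x).2.2

/-- `{x} ⊆ chartNhd x`. [folklore] -/
theorem singleton_subset_chartNhd : ({x} : Set M) ⊆ J.complexTangentBundle.chartNhd x :=
  singleton_subset_iff.2 (mem_of_mem_nhds (J.complexTangentBundle.chartNhd_spec x).1)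

/-- The local product structure of `D` over the point `x` (atlas chart of `(TM, J)` at `x`, on the
closed chart neighbourhood `chartNhd x`). [cite: HusemollerFibreBundles1994, Ch. 17 Def. 2.1] -/
abbrev fibreTriv : ↥(J.complexTangentBundle.compl.projMap ⁻¹' ({x} : Set M)) ≃ₜ
    ↥({x} : Set M) × ℙ ℂ (J.complexTangentBundle.F × ℂ) :=
  J.complexTangentBundle.complOverHomeomorph x (J.chartNhd_subset_baseSet x) (J.singleton_subset_chartNhd x)

/-- `ℓ ↦ (x, ℓ)`. [folklore] -/
abbrev fibreSlice : C(ℙ ℂ (J.complexTangentBundle.F × ℂ), ↥({x} : Set M) × ℙ ℂ (J.complexTangentBundle.F × ℂ)) :=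
  (ContinuousMap.const _ (⟨x, rfl⟩ : ↥({x} : Set M))).prodMk (ContinuousMap.id _)

/-- **The fibre inclusion `κ_x : ℙ(F ⊕ ℂ) → D` over `x`** through the atlas trivialisation. [cite: MilnorStasheff1974, §11 Lemma 11.9] -/
abbrev fibreIncl : C(ℙ ℂ (J.complexTangentBundle.F × ℂ), J.complexTangentBundle.compl.Proj) :=
  (subsetIncl (J.complexTangentBundle.compl.projMap ⁻¹' ({x} : Set M))).comp
    (((J.fibreTriv x).symm : C(↥({x} : Set M) × ℙ ℂ (J.complexTangentBundle.F × ℂ),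
        ↥(J.complexTangentBundle.compl.projMap ⁻¹' ({x} : Set M)))).comp (J.fibreSlice x))

omit [TopologicalSpace M] [T2Space M] [CompactSpace M] [ChartedSpace (EuclideanSpace ℝ (Fin 4)) M] [IsManifold (𝓡 4) ∞ M] in
/-- The points of `↥{x}` are all `x`. [folklore] -/
theorem subsingleton_singleton_coe : Subsingleton (↥({x} : Set M)) :=
  ⟨fun a b ↦ Subtype.ext ((mem_singleton_iff.1 a.2).trans (mem_singleton_iff.1 b.2).symm)⟩

/-- `κ_x` lands in the fibre over `x`: `q̂ ∘ κ_x = x`. [folklore] -/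
theorem proj_fibreIncl (ℓ : ℙ ℂ (J.complexTangentBundle.F × ℂ)) : (J.fibreIncl x ℓ).proj = x := by
  have h := J.complexTangentBundle.complOverHomeomorph_fst x (J.chartNhd_subset_baseSet x) (J.singleton_subset_chartNhd x)
    ((J.fibreTriv x).symm (J.fibreSlice x ℓ))
  rw [Homeomorph.apply_symm_apply] at h
  exact h.symm

/-- `κ_x` is a map of pairs `(ℙ(F ⊕ ℂ), ℙ ∖ [0 : 1]) → (D, D ∖ s₀)`. [folklore] -/
theorem mapsTo_fibreIncl : MapsTo (J.fibreIncl x) (modelVectorPart J.complexTangentBundle.F)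
    (vectorPart J.complexTangentBundle.F J.complexTangentBundle.E) := fun ℓ hℓ ↦
  J.complexTangentBundle.mapsTo_complOverHomeomorph_symm x (J.chartNhd_subset_baseSet x) (J.singleton_subset_chartNhd x)
    (show J.fibreSlice x ℓ ∈ prodVectorPart _ _ from hℓ)

/-- **`φ_x = κ_x ∘ α ∘ (frame)`**: `[w : 1] ∈ D_x` is the fibre inclusion of `[frame w : 1]`. [folklore] -/
theorem fibreMap_eq_comp :
    J.fibreMap x = (J.fibreIncl x).comp ((vecEmbed J.complexTangentBundle.F).comp (J.fibreFrame x)) := by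
  haveI := subsingleton_singleton_coe x
  refine ContinuousMap.ext fun w ↦ ?_
  have hpt : (⟨J.fibreMap x w, rfl⟩ : ↥(J.complexTangentBundle.compl.projMap ⁻¹' ({x} : Set M))) =
      (J.fibreTriv x).symm (J.fibreSlice x (vecEmbed J.complexTangentBundle.F (J.fibreFrame x w))) := by
    apply (J.fibreTriv x).injective
    rw [Homeomorph.apply_symm_apply]
    refine Prod.ext (Subsingleton.elim _ _) ?_
    exact J.complexTangentBundle.complOverHomeomorph_snd_mk x (J.chartNhd_subset_baseSet x) (J.singleton_subset_chartNhd x)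
      (mem_singleton x) (((J.complexTangentCore_fiberEquiv x).symm w, (1 : ℂ)) : J.complexTangentBundle.compl.E x)
      (pair_one_ne_zero _)
  exact congrArg Subtype.val hpt

/-- **The fibre class `t̃_x = κ_x^* t̃ ∈ H⁴(ℙ(F ⊕ ℂ), ℙ ∖ [0 : 1]; 𝔽₂)`.** [cite: MilnorStasheff1974, §9 Thm. 9.1] -/
def fibreClass : relSingularCohomology (ZMod 2) (ZMod 2) (ℙ ℂ (J.complexTangentBundle.F × ℂ))
    (modelVectorPart J.complexTangentBundle.F) 4 :=
  relSingularCohomology.map (ZMod 2) (ZMod 2) (J.fibreIncl x) (J.mapsTo_fibreIncl x) 4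
    (ComplexVectorBundle.relDegCast (ZMod 2) J.two_mul_rank_complexTangentBundle_four
      (J.complexTangentBundle.relComplThomClass (ZMod 2) J.rank_complexTangentBundle_four_pos))

/-- **`κ_x^* y = x_{F ⊕ ℂ}`**: the class of the completed bundle restricts on the fibre to the
tautological class (`resCls_lineEuler_eq` for `E ⊕ ℂ` over `{x}`). [cite: HusemollerFibreBundles1994, Ch. 17 §2] -/
theorem map_fibreIncl_yClass :
    singularCohomology.map (ZMod 2) (ZMod 2) (J.fibreIncl x) 2 (J.complexTangentBundle.yClass (ZMod 2)) =
      tautEuler (J.complexTangentBundle.F × ℂ) (ZMod 2) 1 := by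
  have hres := resCls_lineEuler_eq (E := J.complexTangentBundle.compl)
    (J.complexTangentBundle.compl.k0 J.complexTangentBundle.rank_compl_pos) (ZMod 2) x
    (J.complexTangentBundle.subset_baseSet_compl_triv x (J.chartNhd_subset_baseSet x))
    (J.complexTangentBundle.chartNhd_spec x).2.1 (J.singleton_subset_chartNhd x)
  show singularCohomology.map (ZMod 2) (ZMod 2)
      ((subsetIncl (J.complexTangentBundle.compl.projMap ⁻¹' ({x} : Set M))).comp
        (((J.fibreTriv x).symm : C(↥({x} : Set M) × ℙ ℂ (J.complexTangentBundle.F × ℂ),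
            ↥(J.complexTangentBundle.compl.projMap ⁻¹' ({x} : Set M)))).comp (J.fibreSlice x))) 2
      (J.complexTangentBundle.compl.lineEuler (J.complexTangentBundle.compl.k0 J.complexTangentBundle.rank_compl_pos) (ZMod 2) 1) = _
  rw [singularCohomology.map_comp, ModuleCat.comp_apply, hres, ← ModuleCat.comp_apply, ← singularCohomology.map_comp,
    ← ModuleCat.comp_apply, ← singularCohomology.map_comp]
  have key : ∀ (f : C(ℙ ℂ (J.complexTangentBundle.F × ℂ), ℙ ℂ (J.complexTangentBundle.F × ℂ)))
      (z : singularCohomology (ZMod 2) (ZMod 2) (ℙ ℂ (J.complexTangentBundle.F × ℂ)) 2),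
      f = ContinuousMap.id _ → singularCohomology.map (ZMod 2) (ZMod 2) f 2 z = z := by
    rintro f z rfl
    rw [singularCohomology.map_id]
    rfl
  refine key _ _ (ContinuousMap.ext fun q ↦ ?_)
  change ((J.fibreTriv x) ((J.fibreTriv x).symm (J.fibreSlice x q))).2 = q
  rw [Homeomorph.apply_symm_apply]
  rfl

/-- **`κ_x^* t = xᵏ`** (`k = rank`): on the fibre the Chern class terms of `t = yᵏ + Σ q̂^*c_{k-j} yʲ` die
(`q̂ ∘ κ_x` is constant and `H^{>0}(pt) = 0`) and `κ_x^* y = x`. [cite: MilnorStasheff1974, §10 Thm. 10.4] -/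
theorem map_fibreIncl_complThomClass :
    singularCohomology.map (ZMod 2) (ZMod 2) (J.fibreIncl x) (2 * J.complexTangentBundle.rank)
        (J.complexTangentBundle.complThomClass (ZMod 2)) =
      xpow (ZMod 2) (J.complexTangentBundle.F × ℂ) J.complexTangentBundle.rank := by
  haveI := subsingleton_singleton_coe x
  set q₁ : C(ℙ ℂ (J.complexTangentBundle.F × ℂ), ↥({x} : Set M)) := ContinuousMap.const _ ⟨x, rfl⟩ with hq₁
  have hsq : J.complexTangentBundle.compl.projMap.comp (J.fibreIncl x) = (subsetIncl ({x} : Set M)).comp q₁ :=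
    ContinuousMap.ext fun ℓ ↦ J.proj_fibreIncl x ℓ
  have hc : (fun j : Fin J.complexTangentBundle.rank ↦ singularCohomology.map (ZMod 2) (ZMod 2) (subsetIncl ({x} : Set M))
      (2 * (J.complexTangentBundle.rank - (j : ℕ))) (J.complexTangentBundle.chernClassR (ZMod 2) (J.complexTangentBundle.rank - (j : ℕ)))) =
      fun _ ↦ 0 := by
    funext j
    haveI := ModuleCat.subsingleton_of_isZero (singularCochainComplex.isZero_singularCohomology_of_subsingleton'
      (R := ZMod 2) (M := ZMod 2) (X := ↥({x} : Set M)) (n := 2 * (J.complexTangentBundle.rank - (j : ℕ)))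
      (by have := j.isLt; omega))
    exact Subsingleton.elim _ _
  rw [ComplexVectorBundle.complThomClass, map_add, map_cupPow, J.map_fibreIncl_yClass,
    map_lhSum (ZMod 2) q₁ J.complexTangentBundle.compl.projMap (J.fibreIncl x) (subsetIncl ({x} : Set M)) hsq _
      (J.complexTangentBundle.yClass (ZMod 2)) rfl, hc, lhSum]
  rw [Finset.sum_eq_zero fun j _ ↦ by rw [map_zero, LinearMap.map_zero₂], add_zero]
  rfl

/-- **`t̃_x` lifts `xᵏ` (transported to degree `4`).** [cite: MilnorStasheff1974, §9 Thm. 9.1] -/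
theorem toAbsolute_fibreClass :
    relSingularCohomology.toAbsolute (ZMod 2) (ZMod 2) _ (modelVectorPart J.complexTangentBundle.F) 4 (J.fibreClass x) =
      degCast (ZMod 2) J.two_mul_rank_complexTangentBundle_four (xpow (ZMod 2) (J.complexTangentBundle.F × ℂ) J.complexTangentBundle.rank) := by
  rw [fibreClass, ← ModuleCat.comp_apply, relSingularCohomology.map_comp_toAbsolute, ModuleCat.comp_apply,
    ComplexVectorBundle.toAbsolute_relDegCast, ComplexVectorBundle.toAbsolute_relComplThomClass, map_degCast,
    J.map_fibreIncl_complThomClass]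

/-- **The fibre class is non-zero** (`xᵏ ≠ 0` in `H²ᵏ(ℙᵏ; 𝔽₂)`). [cite: MilnorStasheff1974, §9 Thm. 9.1] -/
theorem fibreClass_ne_zero : J.fibreClass x ≠ 0 := by
  intro h0
  have h := J.toAbsolute_fibreClass x
  rw [h0, map_zero] at h
  have hF : Module.finrank ℂ J.complexTangentBundle.F = J.complexTangentBundle.rank := rfl
  have hx : xpow (ZMod 2) (J.complexTangentBundle.F × ℂ) J.complexTangentBundle.rank ≠ 0 :=
    xpow_top_ne_zero (ZMod 2) (J.complexTangentBundle.F × ℂ) (finrank_model_prod_succ J.complexTangentBundle.F hF)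
  exact hx ((degCast (ZMod 2) J.two_mul_rank_complexTangentBundle_four).map_eq_zero_iff.1 h.symm)

/-- **`φ_x^* t̃ ≠ 0` in `H⁴(T_xM, T_xM ∖ 0; 𝔽₂)`**: `φ_x = κ_x ∘ α ∘ frame`, the fibre class `κ_x^* t̃` is
non-zero, and `α`, `frame` are open embeddings fixing the base points, hence injective on `H⁴` of the
punctured pairs (field coefficients). [cite: MilnorStasheff1974, §9 Thm. 9.1 and §11 Lemma 11.9] -/
theorem relMap_fibreMap_ne_zero :
    relSingularCohomology.map (ZMod 2) (ZMod 2) (J.fibreMap x) (J.mapsTo_fibreMap x) 4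
      (ComplexVectorBundle.relDegCast (ZMod 2) J.two_mul_rank_complexTangentBundle_four
        (J.complexTangentBundle.relComplThomClass (ZMod 2) J.rank_complexTangentBundle_four_pos)) ≠ 0 := by
  have hα : MapsTo (vecEmbed J.complexTangentBundle.F) ({0}ᶜ : Set J.complexTangentBundle.F) (modelVectorPart J.complexTangentBundle.F) :=
    mapsTo_compl_singleton_of_injective (isOpenEmbedding_vecEmbed J.complexTangentBundle.F).injective
      (vecEmbed_zero J.complexTangentBundle.F)
  have hβ : MapsTo (J.fibreFrame x) ({0}ᶜ : Set (EuclideanSpace ℝ (Fin 4))) ({0}ᶜ : Set J.complexTangentBundle.F) :=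
    mapsTo_compl_singleton_of_injective (J.isOpenEmbedding_fibreFrame x).injective (J.fibreFrame_zero x)
  rw [relSingularCohomology.map_congr (J.fibreMap_eq_comp x) (J.mapsTo_fibreMap x) ((J.mapsTo_fibreIncl x).comp (hα.comp hβ)) 4,
    relSingularCohomology.map_comp ((vecEmbed J.complexTangentBundle.F).comp (J.fibreFrame x)) (J.fibreIncl x)
      (hα.comp hβ) (J.mapsTo_fibreIncl x) 4, ModuleCat.comp_apply,
    relSingularCohomology.map_comp (J.fibreFrame x) (vecEmbed J.complexTangentBundle.F) hβ hα 4, ModuleCat.comp_apply]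
  intro h0
  have h1 := relMap_injective_of_isOpenEmbedding (J.fibreFrame x) (J.isOpenEmbedding_fibreFrame x) 0 (J.fibreFrame_zero x) 4
    (h0.trans (map_zero _).symm)
  have h2 := relMap_injective_of_isOpenEmbedding (vecEmbed J.complexTangentBundle.F)
    (isOpenEmbedding_vecEmbed J.complexTangentBundle.F) 0 (vecEmbed_zero J.complexTangentBundle.F) 4
    (h1.trans (map_zero _).symm)
  exact J.fibreClass_ne_zero x h2

/-! #### Assembly -/

include he0 in
/-- **`u'_x ≠ 0`**: its restriction to the slice neighbourhood is `L_x^*(φ_x^* t̃)` with `L_x` an open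
embedding fixing the base points and `φ_x^* t̃ ≠ 0`. [cite: MilnorStasheff1974, §11 Lemma 11.9] -/
theorem sliceRelClass_ne_zero : J.sliceRelClass ex e he hez hΔ x ≠ 0 := by
  intro h0
  have h := J.map_subsetIncl_sliceRelClass ex e he hez hΔ x
  rw [h0, map_zero] at h
  have hL : MapsTo (sliceLog ex e he x) ({slicePt e hΔ x}ᶜ : Set ↥(sliceMap x ⁻¹' e.target)) ({0}ᶜ : Set (EuclideanSpace ℝ (Fin 4))) :=
    mapsTo_compl_singleton_of_injective (isOpenEmbedding_sliceLog ex e he x).injective (sliceLog_slicePt ex e he hez he0 hΔ x)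
  rw [relSingularCohomology.map_congr (J.sliceComposite_eq ex e he x) (J.mapsTo_sliceComposite ex e he hez hΔ x)
      ((J.mapsTo_fibreMap x).comp hL) 4,
    relSingularCohomology.map_comp (sliceLog ex e he x) (J.fibreMap x) hL (J.mapsTo_fibreMap x) 4, ModuleCat.comp_apply] at h
  exact J.relMap_fibreMap_ne_zero x (relMap_injective_of_isOpenEmbedding (sliceLog ex e he x)
    (isOpenEmbedding_sliceLog ex e he x) (slicePt e hΔ x) (sliceLog_slicePt ex e he hez he0 hΔ x) 4
    (h.symm.trans (map_zero _).symm))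

include he0 in
/-- **Milnor–Stasheff Lemma 11.9, mod 2: `⟨j_x^* u'', [M]₂⟩ = 1`** — the diagonal class restricts on each
slice `x × M` to the dual of the point. [cite: MilnorStasheff1974, §11 Lemma 11.9] -/
theorem kroneckerPairing_map_sliceMap_diagClass_eq_one :
    kroneckerPairing (ZMod 2) (ZMod 2) M 4
      (singularCohomology.map (ZMod 2) (ZMod 2) (sliceMap x) 4 (J.diagClass ex e he hez hΔ)) (modTwoFundamentalClass M 4) = 1 := by
  rw [J.kroneckerPairing_map_sliceMap_diagClass ex e he hez hΔ x]
  exact relKroneckerM_localClass_eq_one_of_ne_zero (modTwoOrientation M 4) x (J.sliceRelClass_ne_zero ex e he hez he0 hΔ x)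

end Fibre

end AlmostComplexStructure

end Literature.Geometry.Symplectic
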